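import Summits.QuantumFields.YangMills.Theorems.FlatTubeReductionSlowFactorPotential
import Summits.QuantumFields.YangMills.Theorems.LuscherReductionTwistedTraceScalingBOSlowSchur
import HarnessLib

/-!
# Slow factors of the `(C2)`-moments core bound: squared affine weights and the `orbitDist² φ²` potential

Support file for the crux `NearFlatRatioLaw` (line `ratepack_v2`, stub `stub_hODpot_A`, step (R2) of
`Cruxes/NearFlatRatioLaw/Lines/ratepack-v7-moments-g18.md`).

The integrated core `L²` estimate `…CoreDefectOrbitMomentSq.defect_core_sq_integral_le_orbit_moments` leaves, for each fibre point, slow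
factors of the form `∫_{orbitDist u ≤ d_O} (∫φ²ρ̄)(u)·(∫ (A(u) + B(u)·orbitDist w)² ρ̄(u, w) dw) du` with `ρ̄ = K̃₁/K₁(1,1)` and
`A(u)², B(u)² ≤ α + β·orbitDist(u)²` on the output window.  `slow_factor_sq_weight_le` evaluates them: the inner integral is
`≤ (P + Q·orbitDist(u)²)/K₁(1,1)` (`…OneSiteKernelOrbitMoment.integral_affine_orbitDist_sq_mul_avgKernel_le` and the row sum
`∫K̃₁ ≤ linkCE`), and the remaining `∫ (∫φ²K̃₁)(u)(P + Q·orbitDist(u)²) du` is moved onto `φ` by `…SlowFactorPotential.integral_smearedSq_mul_affine_le`,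
giving `((P + 2Qm²)·linkCE + Q·(4|E₁|)²·crossBound)·∫φ² + 2Q·linkCE·∫ orbitDist² φ²` over `K₁(1,1)²` — a constant times `‖φ‖²` plus a
constant times the `orbitDist² φ²` POTENTIAL of `stub_hODpot_A`, with no logarithm.
-/

noncomputable section

open MeasureTheory Filter Topology Real
open scoped BigOperators
open Literature.MathematicalPhysics.QuantumFieldTheory
open Literature.MathematicalPhysics.QuantumLattice

namespace Summit.QuantumFields.YangMills.Theorems.FemtoTransferGap.TwoLattice.ConstTube

open Summit.QuantumFields.YangMills.Theorems.FemtoTransferGap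
open Summit.QuantumFields.YangMills.Theorems.FemtoTransferGap.TwoLattice
open Summit.QuantumFields.YangMills.Theorems.FemtoTransferGap.TwoLattice.Avg

/-- ★ **Pointwise inner bound**: for `orbitDist u ≤ d_O` (any `d_O`) and `A(u)² ≤ α_A + β_A·orbitDist(u)²`, `B(u)² ≤ α_B + β_B·orbitDist(u)²`,
`∫ (A(u) + B(u)·orbitDist w)² K̃₁(u, w) dw ≤ P + Q·orbitDist(u)²` with the constants of the module docstring. [folklore] -/
theorem integral_sq_affine_weight_le {B m dO : ℝ} (hB : 0 ≤ B) (hm : 0 ≤ m) {αA βA αB βB : ℝ} (hβB : 0 ≤ βB)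
    {a b : ℝ} {u : GaugeConfig 3 1 SU2} (hu : orbitDist u ≤ dO) (hA : a ^ 2 ≤ αA + βA * orbitDist u ^ 2) (hBc : b ^ 2 ≤ αB + βB * orbitDist u ^ 2) :
    ∫ w, (a + b * orbitDist w) ^ 2 * avgKernel B u w ∂configMeasure SU2 1 ≤
      ((2 * αA + 4 * αB * m ^ 2) * linkCE B + 2 * αB * ((4 * (Fintype.card (Edge 3 1) : ℝ)) ^ 2 * crossBound 1 B m)) +
        ((2 * βA + 4 * (αB + βB * dO ^ 2 + βB * m ^ 2)) * linkCE B + 2 * βB * ((4 * (Fintype.card (Edge 3 1) : ℝ)) ^ 2 * crossBound 1 B m)) * orbitDist u ^ 2 := by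
  have h1 := integral_affine_orbitDist_sq_mul_avgKernel_le hB hm a b u
  have hN0 : 0 ≤ ∫ u', avgKernel B u u' ∂configMeasure SU2 1 := integral_nonneg fun u' => (avgKernel_pos B u u').le
  have hN : ∫ u', avgKernel B u u' ∂configMeasure SU2 1 ≤ linkCE B := integral_avgKernel_one_le_linkCE hB u
  have hcb : 0 ≤ (4 * (Fintype.card (Edge 3 1) : ℝ)) ^ 2 * crossBound 1 B m := mul_nonneg (sq_nonneg _) (crossBound_pos (L := 1) B m).le
  have hod0 : 0 ≤ orbitDist u ^ 2 := sq_nonneg _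
  have hod : orbitDist u ^ 2 ≤ dO ^ 2 := pow_le_pow_left₀ (orbitDist_nonneg u) hu 2
  -- the coefficient of the row sum
  have hc0 : 0 ≤ 2 * a ^ 2 + 4 * b ^ 2 * (orbitDist u ^ 2 + m ^ 2) := by positivity
  have hc1 : 2 * a ^ 2 + 4 * b ^ 2 * (orbitDist u ^ 2 + m ^ 2) ≤
      (2 * αA + 4 * αB * m ^ 2) + (2 * βA + 4 * (αB + βB * dO ^ 2 + βB * m ^ 2)) * orbitDist u ^ 2 := by
    have e1 : b ^ 2 * orbitDist u ^ 2 ≤ (αB + βB * orbitDist u ^ 2) * orbitDist u ^ 2 := mul_le_mul_of_nonneg_right hBc hod0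
    have e2 : βB * orbitDist u ^ 2 * orbitDist u ^ 2 ≤ βB * dO ^ 2 * orbitDist u ^ 2 :=
      mul_le_mul_of_nonneg_right (mul_le_mul_of_nonneg_left hod hβB) hod0
    have e3 : b ^ 2 * m ^ 2 ≤ (αB + βB * orbitDist u ^ 2) * m ^ 2 := mul_le_mul_of_nonneg_right hBc (sq_nonneg _)
    nlinarith
  have h2 : (2 * a ^ 2 + 4 * b ^ 2 * (orbitDist u ^ 2 + m ^ 2)) * ∫ u', avgKernel B u u' ∂configMeasure SU2 1 ≤
      ((2 * αA + 4 * αB * m ^ 2) + (2 * βA + 4 * (αB + βB * dO ^ 2 + βB * m ^ 2)) * orbitDist u ^ 2) * linkCE B :=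
    mul_le_mul hc1 hN hN0 (hc0.trans hc1)
  have h3 : 2 * b ^ 2 * ((4 * (Fintype.card (Edge 3 1) : ℝ)) ^ 2 * crossBound 1 B m) ≤
      2 * (αB + βB * orbitDist u ^ 2) * ((4 * (Fintype.card (Edge 3 1) : ℝ)) ^ 2 * crossBound 1 B m) :=
    mul_le_mul_of_nonneg_right (by linarith) hcb
  nlinarith

/-- ★★★ **THE SLOW FACTOR WITH THE POTENTIAL**: for `B, m ≥ 0`, any `d_O`, a bounded measurable `φ`, and weights `A, B` with
`A(u)² ≤ α_A + β_A·orbitDist(u)²`, `B(u)² ≤ α_B + β_B·orbitDist(u)²` on `{orbitDist ≤ d_O}`,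
`∫ 𝟙{orbitDist u ≤ d_O}·(∫φ²ρ̄(u,·))·(∫(A(u) + B(u)·orbitDist w)²ρ̄(u,w) dw) du ≤ (((P + 2Qm²)·linkCE + Q·(4|E₁|)²·crossBound)·∫φ² + 2Q·linkCE·∫orbitDist²φ²)/K₁(1,1)²`,
`ρ̄ = K̃₁/K₁(1,1)`, with `P, Q` the constants of `integral_sq_affine_weight_le`. [folklore] -/
theorem slow_factor_sq_weight_le {B m dO : ℝ} (hB : 0 ≤ B) (hm : 0 ≤ m) {φ : GaugeConfig 3 1 SU2 → ℝ} (hφm : Measurable φ)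
    {Cφ : ℝ} (hφb : ∀ u, |φ u| ≤ Cφ) {A Bc : GaugeConfig 3 1 SU2 → ℝ} {αA βA αB βB : ℝ} (hαA : 0 ≤ αA) (hβA : 0 ≤ βA) (hαB : 0 ≤ αB) (hβB : 0 ≤ βB)
    (hA : ∀ u, orbitDist u ≤ dO → A u ^ 2 ≤ αA + βA * orbitDist u ^ 2) (hBc : ∀ u, orbitDist u ≤ dO → Bc u ^ 2 ≤ αB + βB * orbitDist u ^ 2) :
    ∫ u, {u : GaugeConfig 3 1 SU2 | orbitDist u ≤ dO}.indicator (fun _ => (1 : ℝ)) u *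
        ((∫ w, φ w ^ 2 * (avgKernel B u w / transferKernel su2Rep B (1 : GaugeConfig 3 1 SU2) 1) ∂configMeasure SU2 1) *
          ∫ w, (A u + Bc u * orbitDist w) ^ 2 * (avgKernel B u w / transferKernel su2Rep B (1 : GaugeConfig 3 1 SU2) 1) ∂configMeasure SU2 1) ∂configMeasure SU2 1 ≤
      (((((2 * αA + 4 * αB * m ^ 2) * linkCE B + 2 * αB * ((4 * (Fintype.card (Edge 3 1) : ℝ)) ^ 2 * crossBound 1 B m)) +
              2 * ((2 * βA + 4 * (αB + βB * dO ^ 2 + βB * m ^ 2)) * linkCE B + 2 * βB * ((4 * (Fintype.card (Edge 3 1) : ℝ)) ^ 2 * crossBound 1 B m)) * m ^ 2) * linkCE B +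
            ((2 * βA + 4 * (αB + βB * dO ^ 2 + βB * m ^ 2)) * linkCE B + 2 * βB * ((4 * (Fintype.card (Edge 3 1) : ℝ)) ^ 2 * crossBound 1 B m)) *
              ((4 * (Fintype.card (Edge 3 1) : ℝ)) ^ 2 * crossBound 1 B m)) * ∫ w, φ w ^ 2 ∂configMeasure SU2 1 +
          2 * ((2 * βA + 4 * (αB + βB * dO ^ 2 + βB * m ^ 2)) * linkCE B + 2 * βB * ((4 * (Fintype.card (Edge 3 1) : ℝ)) ^ 2 * crossBound 1 B m)) * linkCE B *
            ∫ w, orbitDist w ^ 2 * φ w ^ 2 ∂configMeasure SU2 1) /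
        transferKernel su2Rep B (1 : GaugeConfig 3 1 SU2) 1 ^ 2 := by
  haveI : SecondCountableTopology SU2 := secondCountableTopology_su2
  -- names
  obtain ⟨K1, hK1⟩ : ∃ K1 : ℝ, K1 = transferKernel su2Rep B (1 : GaugeConfig 3 1 SU2) 1 := ⟨_, rfl⟩
  obtain ⟨cB, hcB⟩ : ∃ cB : ℝ, cB = (4 * (Fintype.card (Edge 3 1) : ℝ)) ^ 2 * crossBound 1 B m := ⟨_, rfl⟩
  obtain ⟨P, hP⟩ : ∃ P : ℝ, P = (2 * αA + 4 * αB * m ^ 2) * linkCE B + 2 * αB * cB := ⟨_, rfl⟩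
  obtain ⟨Q, hQ⟩ : ∃ Q : ℝ, Q = (2 * βA + 4 * (αB + βB * dO ^ 2 + βB * m ^ 2)) * linkCE B + 2 * βB * cB := ⟨_, rfl⟩
  rw [← hK1, ← hcB, ← hP, ← hQ]
  have hK1p : 0 < K1 := by rw [hK1]; exact transferKernel_pos su2Rep _ _ _
  obtain ⟨M, hM⟩ := exists_transferKernel_le su2Rep continuous_su2Rep B (L := 1)
  have hK0 : ∀ u w : GaugeConfig 3 1 SU2, 0 ≤ avgKernel B u w := fun u w => (avgKernel_pos _ _ _).le
  have hKM : ∀ u w : GaugeConfig 3 1 SU2, avgKernel B u w ≤ M := fun u w => avgKernel_le B hM u w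
  have hM0 : 0 ≤ M := (hK0 1 1).trans (hKM 1 1)
  have hN0 : 0 ≤ linkCE B := (integral_nonneg fun u' => hK0 1 u').trans (integral_avgKernel_one_le_linkCE hB 1)
  have hcB0 : 0 ≤ cB := by rw [hcB]; exact mul_nonneg (sq_nonneg _) (crossBound_pos (L := 1) B m).le
  have hP0 : 0 ≤ P := by rw [hP]; positivity
  have hQ0 : 0 ≤ Q := by rw [hQ]; positivity
  have hCφ : 0 ≤ Cφ := (abs_nonneg _).trans (hφb 1)
  have hφ2 : ∀ w, φ w ^ 2 ≤ Cφ ^ 2 := fun w => by rw [← sq_abs]; exact pow_le_pow_left₀ (abs_nonneg _) (hφb w) 2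
  -- the smeared square `S(u) = ∫ φ² K̃(u,·)` and its bound
  have hKm : Measurable fun p : GaugeConfig 3 1 SU2 × GaugeConfig 3 1 SU2 => avgKernel B p.1 p.2 := measurable_avgKernel B
  have hSm : Measurable fun u : GaugeConfig 3 1 SU2 => ∫ w, φ w ^ 2 * avgKernel B u w ∂configMeasure SU2 1 :=
    ((((hφm.comp measurable_snd).pow_const 2).mul hKm).stronglyMeasurable.integral_prod_right' (ν := configMeasure SU2 1)).measurable
  have hS0 : ∀ u, 0 ≤ ∫ w, φ w ^ 2 * avgKernel B u w ∂configMeasure SU2 1 := fun u => integral_nonneg fun w => mul_nonneg (sq_nonneg _) (hK0 u w)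
  have hSb : ∀ u, ∫ w, φ w ^ 2 * avgKernel B u w ∂configMeasure SU2 1 ≤ Cφ ^ 2 * M := fun u => by
    calc ∫ w, φ w ^ 2 * avgKernel B u w ∂configMeasure SU2 1 ≤ ∫ _w, Cφ ^ 2 * M ∂configMeasure SU2 1 :=
          integral_mono_of_nonneg (ae_of_all _ fun w => mul_nonneg (sq_nonneg _) (hK0 u w)) (integrable_const _)
            (ae_of_all _ fun w => mul_le_mul (hφ2 w) (hKM u w) (hK0 u w) (sq_nonneg _))
      _ = Cφ ^ 2 * M := by rw [integral_const, smul_eq_mul, probReal_univ, one_mul]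
  -- dividing by `K₁(1,1)`
  have hdivS : ∀ u, ∫ w, φ w ^ 2 * (avgKernel B u w / K1) ∂configMeasure SU2 1 = (∫ w, φ w ^ 2 * avgKernel B u w ∂configMeasure SU2 1) / K1 := fun u => by
    rw [← integral_div]; exact integral_congr_ae (ae_of_all _ fun w => by ring)
  have hdivG : ∀ u, ∫ w, (A u + Bc u * orbitDist w) ^ 2 * (avgKernel B u w / K1) ∂configMeasure SU2 1 =
      (∫ w, (A u + Bc u * orbitDist w) ^ 2 * avgKernel B u w ∂configMeasure SU2 1) / K1 := fun u => by
    rw [← integral_div]; exact integral_congr_ae (ae_of_all _ fun w => by ring)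
  -- the dominating integrand `g(u) = S(u)·(P + Q·orbitDist(u)²)/K₁²`
  have hod2 : ∀ w : GaugeConfig 3 1 SU2, orbitDist w ^ 2 ≤ (4 * (Fintype.card (Edge 3 1) : ℝ)) ^ 2 := fun w =>
    pow_le_pow_left₀ (orbitDist_nonneg w) (orbitDist_le_four_card w) 2
  have hgint : Integrable (fun u => (∫ w, φ w ^ 2 * avgKernel B u w ∂configMeasure SU2 1) * (P + Q * orbitDist u ^ 2) / K1 ^ 2) (configMeasure SU2 1) := by
    refine integrable_of_measurable_abs_le _ ((hSm.mul (measurable_const.add ((measurable_orbitDist.pow_const 2).const_mul Q))).div_const _)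
      (C := Cφ ^ 2 * M * (P + Q * (4 * (Fintype.card (Edge 3 1) : ℝ)) ^ 2) / K1 ^ 2) fun u => ?_
    have h0 : 0 ≤ P + Q * orbitDist u ^ 2 := by positivity
    rw [abs_of_nonneg (div_nonneg (mul_nonneg (hS0 u) h0) (sq_nonneg _))]
    refine div_le_div_of_nonneg_right ?_ (sq_nonneg _)
    exact mul_le_mul (hSb u) (by nlinarith [hod2 u]) h0 (by positivity)
  -- pointwise domination
  have hpt : ∀ u, {u : GaugeConfig 3 1 SU2 | orbitDist u ≤ dO}.indicator (fun _ => (1 : ℝ)) u *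
      ((∫ w, φ w ^ 2 * (avgKernel B u w / K1) ∂configMeasure SU2 1) * ∫ w, (A u + Bc u * orbitDist w) ^ 2 * (avgKernel B u w / K1) ∂configMeasure SU2 1) ≤
      (∫ w, φ w ^ 2 * avgKernel B u w ∂configMeasure SU2 1) * (P + Q * orbitDist u ^ 2) / K1 ^ 2 := by
    intro u
    have h0 : 0 ≤ (∫ w, φ w ^ 2 * avgKernel B u w ∂configMeasure SU2 1) * (P + Q * orbitDist u ^ 2) / K1 ^ 2 :=
      div_nonneg (mul_nonneg (hS0 u) (by positivity)) (sq_nonneg _)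
    by_cases hu : orbitDist u ≤ dO
    · rw [Set.indicator_of_mem (by exact hu), one_mul, hdivS, hdivG]
      have hin := integral_sq_affine_weight_le hB hm hβB hu (hA u hu) (hBc u hu)
      rw [← hcB, ← hP, ← hQ] at hin
      rw [div_mul_div_comm, ← sq]
      exact div_le_div_of_nonneg_right (mul_le_mul_of_nonneg_left hin (hS0 u)) (sq_nonneg _)
    · rw [Set.indicator_of_notMem (by exact hu), zero_mul]; exact h0
  have hnn : ∀ u, 0 ≤ {u : GaugeConfig 3 1 SU2 | orbitDist u ≤ dO}.indicator (fun _ => (1 : ℝ)) u *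
      ((∫ w, φ w ^ 2 * (avgKernel B u w / K1) ∂configMeasure SU2 1) * ∫ w, (A u + Bc u * orbitDist w) ^ 2 * (avgKernel B u w / K1) ∂configMeasure SU2 1) :=
    fun u => mul_nonneg (Set.indicator_nonneg (fun _ _ => zero_le_one) _)
      (mul_nonneg (integral_nonneg fun w => mul_nonneg (sq_nonneg _) (div_nonneg (hK0 u w) hK1p.le))
        (integral_nonneg fun w => mul_nonneg (sq_nonneg _) (div_nonneg (hK0 u w) hK1p.le)))
  have step1 := integral_mono_of_nonneg (ae_of_all _ hnn) hgint (ae_of_all _ hpt)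
  refine step1.trans ?_
  -- move the affine weight onto `φ`
  have e1 : ∫ u, (∫ w, φ w ^ 2 * avgKernel B u w ∂configMeasure SU2 1) * (P + Q * orbitDist u ^ 2) / K1 ^ 2 ∂configMeasure SU2 1 =
      (∫ u, (∫ w, φ w ^ 2 * avgKernel B u w ∂configMeasure SU2 1) * (P + Q * orbitDist u ^ 2) ∂configMeasure SU2 1) / K1 ^ 2 := integral_div _ _
  rw [e1]
  refine div_le_div_of_nonneg_right ?_ (sq_nonneg _)
  have hA5 := integral_smearedSq_mul_affine_le hB hm hP0 hQ0 hφm hφb (a := P) (b := Q)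
  rw [← hcB] at hA5
  refine hA5.trans ?_
  -- bound the row sums by `linkCE` and split
  have hNw : ∀ w : GaugeConfig 3 1 SU2, ∫ u', avgKernel B w u' ∂configMeasure SU2 1 ≤ linkCE B := fun w => integral_avgKernel_one_le_linkCE hB w
  have hNw0 : ∀ w : GaugeConfig 3 1 SU2, 0 ≤ ∫ u', avgKernel B w u' ∂configMeasure SU2 1 := fun w => integral_nonneg fun u' => hK0 w u'
  have hI1 : Integrable (fun w => φ w ^ 2) (configMeasure SU2 1) :=
    integrable_of_measurable_abs_le _ (hφm.pow_const 2) (C := Cφ ^ 2) fun w => by rw [abs_of_nonneg (sq_nonneg _)]; exact hφ2 w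
  have hI2 : Integrable (fun w => orbitDist w ^ 2 * φ w ^ 2) (configMeasure SU2 1) :=
    integrable_of_measurable_abs_le _ ((measurable_orbitDist.pow_const 2).mul (hφm.pow_const 2)) (C := (4 * (Fintype.card (Edge 3 1) : ℝ)) ^ 2 * Cφ ^ 2) fun w => by
      rw [abs_of_nonneg (mul_nonneg (sq_nonneg _) (sq_nonneg _))]; exact mul_le_mul (hod2 w) (hφ2 w) (sq_nonneg _) (sq_nonneg _)
  have hrhs : Integrable (fun w => ((P + 2 * Q * m ^ 2) * linkCE B + Q * cB) * φ w ^ 2 + 2 * Q * linkCE B * (orbitDist w ^ 2 * φ w ^ 2)) (configMeasure SU2 1) :=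
    (hI1.const_mul _).add (hI2.const_mul _)
  have hpt2 : ∀ w, φ w ^ 2 * ((P + 2 * Q * (orbitDist w ^ 2 + m ^ 2)) * ∫ u', avgKernel B w u' ∂configMeasure SU2 1 + Q * cB) ≤
      ((P + 2 * Q * m ^ 2) * linkCE B + Q * cB) * φ w ^ 2 + 2 * Q * linkCE B * (orbitDist w ^ 2 * φ w ^ 2) := fun w => by
    have hc0 : 0 ≤ P + 2 * Q * (orbitDist w ^ 2 + m ^ 2) := by positivity
    have h1 : (P + 2 * Q * (orbitDist w ^ 2 + m ^ 2)) * ∫ u', avgKernel B w u' ∂configMeasure SU2 1 ≤ (P + 2 * Q * (orbitDist w ^ 2 + m ^ 2)) * linkCE B :=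
      mul_le_mul_of_nonneg_left (hNw w) hc0
    have h2 := mul_le_mul_of_nonneg_left (add_le_add_right h1 (Q * cB)) (sq_nonneg (φ w))
    have e : φ w ^ 2 * ((P + 2 * Q * (orbitDist w ^ 2 + m ^ 2)) * linkCE B + Q * cB) =
        ((P + 2 * Q * m ^ 2) * linkCE B + Q * cB) * φ w ^ 2 + 2 * Q * linkCE B * (orbitDist w ^ 2 * φ w ^ 2) := by ring
    linarith
  have hlhs2 : Integrable (fun w => φ w ^ 2 * ((P + 2 * Q * (orbitDist w ^ 2 + m ^ 2)) * ∫ u', avgKernel B w u' ∂configMeasure SU2 1 + Q * cB)) (configMeasure SU2 1) := by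
    have hIm : Measurable fun w : GaugeConfig 3 1 SU2 => ∫ u', avgKernel B w u' ∂configMeasure SU2 1 :=
      (hKm.stronglyMeasurable.integral_prod_right' (ν := configMeasure SU2 1)).measurable
    refine integrable_of_measurable_abs_le _ ((hφm.pow_const 2).mul (((measurable_const.add (((measurable_orbitDist.pow_const 2).add measurable_const).const_mul _)).mul hIm).add measurable_const))
      (C := ((P + 2 * Q * m ^ 2) * linkCE B + Q * cB) * Cφ ^ 2 + 2 * Q * linkCE B * ((4 * (Fintype.card (Edge 3 1) : ℝ)) ^ 2 * Cφ ^ 2)) fun w => ?_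
    have hc0 : 0 ≤ P + 2 * Q * (orbitDist w ^ 2 + m ^ 2) := by positivity
    rw [abs_of_nonneg (mul_nonneg (sq_nonneg _) (add_nonneg (mul_nonneg hc0 (hNw0 w)) (mul_nonneg hQ0 hcB0)))]
    refine (hpt2 w).trans ?_
    have h1 := mul_le_mul_of_nonneg_left (hφ2 w) (add_nonneg (mul_nonneg (by positivity : 0 ≤ P + 2 * Q * m ^ 2) hN0) (mul_nonneg hQ0 hcB0))
    have h2 := mul_le_mul_of_nonneg_left (mul_le_mul (hod2 w) (hφ2 w) (sq_nonneg _) (sq_nonneg _)) (mul_nonneg (mul_nonneg two_pos.le hQ0) hN0)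
    linarith
  have step2 := integral_mono hlhs2 hrhs hpt2
  refine step2.trans (le_of_eq ?_)
  rw [integral_add (hI1.const_mul _) (hI2.const_mul _), integral_const_mul, integral_const_mul]

end Summit.QuantumFields.YangMills.Theorems.FemtoTransferGap.TwoLattice.ConstTube

end
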